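import Literature.NumberTheory.EllipticCurves.IwasawaAlgebraRankOneIdealProofs
import Literature.NumberTheory.EllipticCurves.IwasawaAlgebraPromotionProofs
import Mathlib.RingTheory.Filtration
import HarnessLib

/-!
# The height-one criterion for divisibility up to a power of a fixed prime element

Generic commutative algebra (everything PROVED; no definition, no named fact), the IDEAL-THEORETIC
companion of the tree's two bridges between "length inequalities at the height-one primes `𝔮 ∌ π₀`"
and divisibilities up to a power of `π₀`
(`Literature.NumberTheory.EllipticCurves.Module.exists_pow_mul_mem_charIdeal_of_lengthAt_le`, file
`IwasawaAlgebraDivisibilityProofs` — Kato's direction; `…Module.charIdeal_le_span_singleton_pow_of_le_lengthAt`,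
file `IwasawaAlgebraPromotionProofs`). Over a Noetherian UFD `R` (e.g. `Λ = ℤ_p⟦T⟧`, `Λ^ur = R₀⟦T⟧`)
with a prime element `π₀` (e.g. `π₀ = p`):

> if an ideal `I` is at least as divisible as the principal ideal `(L)`, `L ≠ 0`, at every height-one
> prime `𝔮` not containing `π₀` — `(L) ⊆ 𝔮ⁿ ⟹ I ⊆ 𝔮ⁿ` for all `n` — then `π₀ᵏ · I ⊆ (L)` for some `k`
> (`Ideal.exists_pow_mul_mem_span_of_forall_heightOne`; one may take `k = ord_{π₀}(L)`).

This is the last, purely algebraic step of every Eisenstein-congruence lower bound for a Selmer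
group: such an argument delivers `ord_𝔮(L) ≤ length_𝔮(X)` prime by prime at the height-one primes
`𝔮 ≠ (p)` (e.g. Castella–Liu–Wan, Forum Math. Sigma 10 (2022), proof of Thm. 8.2.1: "We reduce to show
that given a height one prime ideal `P` … we have the inequality `ord_P(𝓛) ≤ length_P(X_P)`",
`[corpus: paper:arxiv-2109.08375 p0055 L48–L52]`), and the consumer wants "`pᵏ · char(X) ⊆ (L)`"
(the `∃ k, C (p ^ k) * G ∈ Ideal.span {L}` currency of the BSD cell's Wan-frame items, e.g.
`Summit.…UniversalToricDescent.TwinWanFrameAtThreeGoodSSApZeroT`, and of the support Prop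
`SpanOfHeightOneDivisibilityAtThree` of the idea card `higher-klingen-gu22` on it, whose text is the
`R = R₀⟦T⟧`, `π₀ = C 3` instance of `PowerSeries.exists_C_pow_mul_mem_span_of_forall_heightOne`
below — the consumer supplies `IsPrincipalIdealRing (unrIntegers 3)` and `Prime (3 : unrIntegers 3)`
from `Summit.…X2.HidaLimitCongruenceAlgebra`).

Proof (Bourbaki AC VII §4.5 / Washington §13.2 bookkeeping): for `G ∈ I`, `G ≠ 0`, and a height-one
prime `𝔮 = (π) ∌ π₀` write `L = π^e a`, `π ∤ a`; then `(L) ⊆ 𝔮^e`, so `G ∈ 𝔮^e = (π^e)`, i.e.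
`length_𝔮 R/(L) = e ≤ length_𝔮 R/(G)`; the bridge `exists_pow_mul_mem_charIdeal_of_lengthAt_le`
applied to the torsion module `X = R/(L)` (whose characteristic ideal is `(L)`,
`Module.charIdeal_quotient_span_singleton`) gives `π₀^m G ∈ (L)`; a uniform exponent over the finitely
many generators of `I` follows. For power series rings the degenerate case `L = 0` is Krull's
intersection theorem at the height-one prime `(X)` (`Ideal.iInf_pow_eq_bot_of_isDomain`).

* `Module.le_lengthAt_quotient_span_singleton_of_pow_dvd` — `π^e ∣ G ≠ 0 ⟹ e ≤ length_{(π)} R/(G)`.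
* `Module.lengthAt_quotient_span_singleton_le_of_forall_pow_le` — the hypothesis at one `𝔮 = (π)` gives
  `length_𝔮 R/(L) ≤ length_𝔮 R/(G)` for `G ∈ I`, `G ≠ 0`.
* `Ideal.exists_pow_mul_mem_span_of_forall_heightOne` (**the criterion**, `L ≠ 0`) and its ideal form
  `Ideal.exists_span_pow_mul_le_span_of_forall_heightOne`.
* `PowerSeries.exists_pow_mul_mem_span_of_forall_heightOne`, `PowerSeries.exists_C_pow_mul_mem_span_of_forall_heightOne`
  — `R = 𝒪⟦X⟧` over a PID `𝒪`, any `L` (the case `L = 0` included), `π₀` a prime power series with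
  non-zero constant term, resp. `π₀ = C ϖ` for a prime `ϖ` of `𝒪`.
* `Module.exists_span_pow_mul_charIdeal_le_span_of_lengthAt_le` (**the Eisenstein-direction bridge**,
  appended): for a finitely generated torsion module `X`, `length_𝔮 R/(L) ≤ length_𝔮 X` at every
  height-one `𝔮 ∌ π₀` (Castella–Liu–Wan's printed reduction "`ord_P(𝓛) ≤ length_P(X_P)`") gives
  `(π₀ ^ k) · char(X) ⊆ (L)` — the exact converse companion of
  `Module.exists_pow_mul_mem_charIdeal_of_lengthAt_le` (Kato's direction).

References: N. Bourbaki, *Algèbre commutative* VII §4.5; L. Washington, *Introduction to Cyclotomic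
Fields* §13.2 (height-one primes of `Λ`, `ord_𝔮`); F. Castella, Z. Liu, X. Wan, Forum Math. Sigma 10
(2022) e110, proof of Thm. 8.2.1 (the reduction to height-one primes). Mathlib supplies
`WfDvdMonoid.max_power_factor`, `Prime.pow_dvd_of_dvd_mul_right`, `pow_dvd_pow_iff`,
`Ideal.eq_span_singleton_of_height_eq_one`, `Ideal.iInf_pow_eq_bot_of_isDomain`,
`Ideal.height_span_singleton_eq_one_of_mem_nonZeroDivisors`, the UFD instance of `𝒪⟦X⟧` for a PID `𝒪`.
BSD is not advanced by this file; it proves no arithmetic.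
-/

noncomputable section

namespace Literature.NumberTheory.EllipticCurves

namespace Module

/-! ### `ord_π` bookkeeping: `π^e ∣ G ⟹ e ≤ length_{(π)} R/(G)` -/

section Ord

variable {R : Type*} [CommRing R] [IsDomain R] [IsNoetherianRing R]

/-- For a prime element `π`, `𝔭 = (π)` and `G ≠ 0`: if `π ^ e ∣ G` then `e ≤ length_{R_𝔭} (R/(G))_𝔭`
(write `G = π^f c`, `π ∤ c`; then `e ≤ f` and the length is `f`). The converse of
`pow_dvd_of_le_lengthAt_quotient` ("`ord_𝔭`" is the exponent of `𝔭` in the characteristic power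
series of `R/(G)`, Washington §13.2). [cite: Washington1997, §13.2] -/
theorem le_lengthAt_quotient_span_singleton_of_pow_dvd {π G : R} (hπ : Prime π) (hG : G ≠ 0)
    (𝔭 : PrimeSpectrum R) (h𝔭 : 𝔭.asIdeal = Ideal.span {π}) {e : ℕ} (h : π ^ e ∣ G) :
    (e : ℕ∞) ≤ lengthAt R (R ⧸ Ideal.span {G}) 𝔭 := by
  obtain ⟨f, c, hc, rfl⟩ := WfDvdMonoid.max_power_factor hG hπ.irreducible
  rw [lengthAt_quotient_span_singleton_pow_mul hπ f hc 𝔭 h𝔭, Nat.cast_le]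
  have hef : π ^ e ∣ π ^ f := hπ.pow_dvd_of_dvd_mul_right e hc h
  exact (pow_dvd_pow_iff hπ.ne_zero hπ.not_unit).mp hef

/-- **The hypothesis of the criterion at one height-one prime.** `π` prime, `𝔭 = (π)`, `L ≠ 0`,
`G ≠ 0`; if `(L) ⊆ 𝔭ⁿ ⟹ G ∈ 𝔭ⁿ` for every `n`, then `length_𝔭 R/(L) ≤ length_𝔭 R/(G)`
(`ord_π L ≤ ord_π G`; Washington §13.2: the characteristic power series of `Λ/(f)` is `f`).
[cite: Washington1997, §13.2] -/
theorem lengthAt_quotient_span_singleton_le_of_forall_pow_le {π L G : R} (hπ : Prime π)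
    (hL : L ≠ 0) (hG : G ≠ 0) (𝔭 : PrimeSpectrum R) (h𝔭 : 𝔭.asIdeal = Ideal.span {π})
    (h : ∀ n : ℕ, Ideal.span {L} ≤ 𝔭.asIdeal ^ n → G ∈ 𝔭.asIdeal ^ n) :
    lengthAt R (R ⧸ Ideal.span {L}) 𝔭 ≤ lengthAt R (R ⧸ Ideal.span {G}) 𝔭 := by
  obtain ⟨e, a, ha, rfl⟩ := WfDvdMonoid.max_power_factor hL hπ.irreducible
  rw [lengthAt_quotient_span_singleton_pow_mul hπ e ha 𝔭 h𝔭]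
  refine le_lengthAt_quotient_span_singleton_of_pow_dvd hπ hG 𝔭 h𝔭 ?_
  have hLe : Ideal.span {π ^ e * a} ≤ 𝔭.asIdeal ^ e := by
    rw [h𝔭, Ideal.span_singleton_pow, Ideal.span_singleton_le_span_singleton]
    exact dvd_mul_right _ _
  have hGe := h e hLe
  rwa [h𝔭, Ideal.span_singleton_pow, Ideal.mem_span_singleton] at hGe

end Ord

end Module

/-! ### The criterion over a Noetherian UFD -/

section Criterion

variable {R : Type*} [CommRing R] [IsDomain R] [IsNoetherianRing R] [UniqueFactorizationMonoid R]

omit [IsNoetherianRing R] [UniqueFactorizationMonoid R] in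
/-- `R ⧸ (L)` is a torsion `R`-module for `L ≠ 0` (any domain; plumbing). [folklore] -/
private theorem Ideal.isTorsion_quotient_span_singleton {L : R} (hL : L ≠ 0) :
    Module.IsTorsion R (R ⧸ Ideal.span {L}) := by
  intro x
  refine ⟨⟨L, mem_nonZeroDivisors_of_ne_zero hL⟩, ?_⟩
  obtain ⟨r, rfl⟩ := Ideal.Quotient.mk_surjective x
  have key : L • Ideal.Quotient.mk (Ideal.span {L}) r = Ideal.Quotient.mk (Ideal.span {L}) (L * r) :=
    rfl
  rw [Submonoid.mk_smul, key, Ideal.Quotient.eq_zero_iff_mem]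
  exact Ideal.mul_mem_right r _ (Ideal.mem_span_singleton_self L)

/-- **One element.** `R` a Noetherian UFD, `π₀` prime, `L ≠ 0`. If `(L) ⊆ 𝔮ⁿ ⟹ G ∈ 𝔮ⁿ` for every
height-one prime `𝔮 ∌ π₀` and every `n`, then `π₀ ^ m * G ∈ (L)` for some `m` (the bridge
`exists_pow_mul_mem_charIdeal_of_lengthAt_le` for the torsion module `R/(L)`, whose characteristic
ideal is `(L)` — Washington §13.2 / NSW (5.3.9)–(5.3.10): `char = ∏_{ht 𝔮 = 1} 𝔮^{ord_𝔮}`).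
[cite: Washington1997, §13.2] [cite: NeukirchSchmidtWingberg2008, Ch. V §3, (5.3.9)–(5.3.10)] -/
theorem Ideal.exists_pow_mul_mem_span_of_forall_heightOne_mem {π₀ L G : R} (hπ₀ : Prime π₀)
    (hL : L ≠ 0)
    (h : ∀ 𝔮 : PrimeSpectrum R, 𝔮.asIdeal.height = 1 → π₀ ∉ 𝔮.asIdeal →
      ∀ n : ℕ, Ideal.span {L} ≤ 𝔮.asIdeal ^ n → G ∈ 𝔮.asIdeal ^ n) :
    ∃ m : ℕ, π₀ ^ m * G ∈ Ideal.span {L} := by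
  by_cases hG : G = 0
  · exact ⟨0, by rw [hG, mul_zero]; exact zero_mem _⟩
  have htors := Ideal.isTorsion_quotient_span_singleton (R := R) hL
  obtain ⟨m, hm⟩ := Module.exists_pow_mul_mem_charIdeal_of_lengthAt_le
    (X := R ⧸ Ideal.span {L}) htors hπ₀ hG (fun 𝔮 h1 hπ₀𝔮 => by
      -- `𝔮` is generated by a prime element `π`
      have hne : 𝔮.asIdeal ≠ ⊥ := by
        intro hbot
        have := h1
        rw [hbot, Ideal.height_bot] at this
        exact zero_ne_one this
      obtain ⟨π, hπ𝔮, hπ⟩ := Ideal.IsPrime.exists_mem_prime_of_ne_bot 𝔮.isPrime hne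
      have h𝔮 : 𝔮.asIdeal = Ideal.span {π} := Ideal.eq_span_singleton_of_height_eq_one h1 hπ𝔮 hπ
      exact Module.lengthAt_quotient_span_singleton_le_of_forall_pow_le hπ hL hG 𝔮 h𝔮
        (h 𝔮 h1 hπ₀𝔮))
  rw [Module.charIdeal_quotient_span_singleton hL] at hm
  exact ⟨m, hm⟩

/-- **The height-one criterion.** `R` a Noetherian UFD (e.g. `ℤ_p⟦T⟧`, `R₀⟦T⟧`), `π₀` a prime
element, `L ≠ 0`, `I` an ideal. If for every height-one prime `𝔮` with `π₀ ∉ 𝔮` and every `n`,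
`(L) ⊆ 𝔮ⁿ ⟹ I ⊆ 𝔮ⁿ` (i.e. `ord_𝔮(L) ≤ ord_𝔮(G)` for all `G ∈ I`), then there is ONE `k` with
`π₀ ^ k * G ∈ (L)` for all `G ∈ I`. (Uniformity over the finitely many generators of `I`.)
[cite: Washington1997, §13.2] [cite: NeukirchSchmidtWingberg2008, Ch. V §3, (5.3.9)–(5.3.10)] -/
theorem Ideal.exists_pow_mul_mem_span_of_forall_heightOne {π₀ L : R} (hπ₀ : Prime π₀) (hL : L ≠ 0)
    {I : Ideal R}
    (h : ∀ 𝔮 : PrimeSpectrum R, 𝔮.asIdeal.height = 1 → π₀ ∉ 𝔮.asIdeal →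
      ∀ n : ℕ, Ideal.span {L} ≤ 𝔮.asIdeal ^ n → I ≤ 𝔮.asIdeal ^ n) :
    ∃ k : ℕ, ∀ G ∈ I, π₀ ^ k * G ∈ Ideal.span {L} := by
  classical
  -- per generator
  have hgen : ∀ G ∈ I, ∃ m : ℕ, π₀ ^ m * G ∈ Ideal.span {L} := fun G hG =>
    Ideal.exists_pow_mul_mem_span_of_forall_heightOne_mem hπ₀ hL
      (fun 𝔮 h1 hπ₀𝔮 n hn => h 𝔮 h1 hπ₀𝔮 n hn hG)
  choose! m hm using hgen
  -- finitely many generators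
  obtain ⟨S, hS⟩ := (IsNoetherian.noetherian I : I.FG)
  refine ⟨∑ G ∈ S, m G, fun G hG => ?_⟩
  rw [← hS] at hG
  refine Submodule.span_induction (p := fun G _ => π₀ ^ (∑ G ∈ S, m G) * G ∈ Ideal.span {L})
    ?_ ?_ ?_ ?_ hG
  · intro G hGS
    have hGI : G ∈ I := by rw [← hS]; exact Ideal.subset_span hGS
    have hle : m G ≤ ∑ G ∈ S, m G :=
      Finset.single_le_sum (fun _ _ => Nat.zero_le _) (Finset.mem_coe.mp hGS)
    rw [← Nat.sub_add_cancel hle, pow_add, mul_assoc]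
    exact Ideal.mul_mem_left _ _ (hm G hGI)
  · rw [mul_zero]; exact zero_mem _
  · intro x y _ _ hx hy
    rw [mul_add]; exact add_mem hx hy
  · intro r x _ hx
    rw [smul_eq_mul, mul_left_comm]
    exact Ideal.mul_mem_left _ _ hx

/-- The criterion in ideal form: `(π₀ ^ k) · I ⊆ (L)`. [cite: Washington1997, §13.2] -/
theorem Ideal.exists_span_pow_mul_le_span_of_forall_heightOne {π₀ L : R} (hπ₀ : Prime π₀)
    (hL : L ≠ 0) {I : Ideal R}
    (h : ∀ 𝔮 : PrimeSpectrum R, 𝔮.asIdeal.height = 1 → π₀ ∉ 𝔮.asIdeal →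
      ∀ n : ℕ, Ideal.span {L} ≤ 𝔮.asIdeal ^ n → I ≤ 𝔮.asIdeal ^ n) :
    ∃ k : ℕ, Ideal.span {π₀ ^ k} * I ≤ Ideal.span {L} := by
  obtain ⟨k, hk⟩ := Ideal.exists_pow_mul_mem_span_of_forall_heightOne hπ₀ hL h
  refine ⟨k, Ideal.mul_le.mpr fun a ha G hG => ?_⟩
  obtain ⟨c, rfl⟩ := Ideal.mem_span_singleton'.mp ha
  rw [mul_assoc]
  exact Ideal.mul_mem_left _ _ (hk G hG)

end Criterion

/-! ### Power series over a PID: the case `L = 0` by Krull's intersection theorem at `(X)` -/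

section PowerSeries

open PowerSeries

variable {𝒪 : Type*} [CommRing 𝒪] [IsDomain 𝒪] [IsPrincipalIdealRing 𝒪]

/-- In `A⟦X⟧` (`A` a Noetherian domain) the ideal `(X)` has height one: Krull's principal ideal
theorem for the non-zero-divisor, non-unit `X`. [cite: Eisenbud1995, Thm. 10.1 (Principal Ideal Theorem)]
[cite: AtiyahMacdonald1969, Cor. 11.17] -/
theorem PowerSeries.height_span_X_eq_one {A : Type*} [CommRing A] [IsDomain A] [IsNoetherianRing A] :
    (Ideal.span {(X : A⟦X⟧)}).height = 1 :=
  Ideal.height_span_singleton_eq_one_of_mem_nonZeroDivisors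
    (mem_nonZeroDivisors_of_ne_zero X_ne_zero) X_prime.not_unit

/-- **The height-one criterion in `𝒪⟦X⟧`, `𝒪` a PID, for an ARBITRARY `L`.** `π₀` a prime power
series with non-zero constant term (so `π₀ ∉ (X)`), `I` an ideal; if `(L) ⊆ 𝔮ⁿ ⟹ I ⊆ 𝔮ⁿ` for every
height-one prime `𝔮 ∌ π₀` and every `n`, then `π₀ ^ k * G ∈ (L)` for all `G ∈ I`, for one `k`. For
`L = 0` the hypothesis at `𝔮 = (X)` forces `I ⊆ ⋂ₙ (X)ⁿ = 0` (Krull's intersection theorem in a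
Noetherian domain). [cite: Washington1997, §13.2]
[cite: AtiyahMacdonald1969, Cor. 10.18 (Krull's intersection theorem for Noetherian domains)] -/
theorem PowerSeries.exists_pow_mul_mem_span_of_forall_heightOne {π₀ : 𝒪⟦X⟧} (hπ₀ : Prime π₀)
    (h0 : constantCoeff π₀ ≠ 0) (L : 𝒪⟦X⟧) (I : Ideal 𝒪⟦X⟧)
    (h : ∀ 𝔮 : PrimeSpectrum 𝒪⟦X⟧, 𝔮.asIdeal.height = 1 → π₀ ∉ 𝔮.asIdeal →
      ∀ n : ℕ, Ideal.span {L} ≤ 𝔮.asIdeal ^ n → I ≤ 𝔮.asIdeal ^ n) :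
    ∃ k : ℕ, ∀ G ∈ I, π₀ ^ k * G ∈ Ideal.span {L} := by
  by_cases hL : L = 0
  · -- `I = 0` by Krull's intersection theorem at `(X)`
    subst hL
    let 𝔮 : PrimeSpectrum 𝒪⟦X⟧ := ⟨Ideal.span {X}, span_X_isPrime⟩
    have hX : π₀ ∉ 𝔮.asIdeal := by
      intro hmem
      exact h0 (X_dvd_iff.mp (Ideal.mem_span_singleton.mp hmem))
    have hI : ∀ n : ℕ, I ≤ 𝔮.asIdeal ^ n := fun n =>
      h 𝔮 PowerSeries.height_span_X_eq_one hX n (by rw [Ideal.span_singleton_zero]; exact bot_le)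
    have hbot : I = ⊥ := by
      refine le_bot_iff.mp ?_
      calc I ≤ ⨅ n : ℕ, 𝔮.asIdeal ^ n := le_iInf hI
        _ = ⊥ := Ideal.iInf_pow_eq_bot_of_isDomain _ span_X_isPrime.ne_top
    refine ⟨0, fun G hG => ?_⟩
    rw [hbot, Ideal.mem_bot] at hG
    rw [hG, mul_zero]
    exact zero_mem _
  · exact Ideal.exists_pow_mul_mem_span_of_forall_heightOne hπ₀ hL h

/-- **The `C ϖ`-form** (the literal shape of the BSD cell's items: `π₀ = C ϖ` for a prime `ϖ` of the
PID `𝒪`, e.g. `ϖ = p` in `ℤ_p` or in `R₀ = unrIntegers p`): if `(L) ⊆ 𝔮ⁿ ⟹ I ⊆ 𝔮ⁿ` for every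
height-one prime `𝔮` of `𝒪⟦X⟧` with `C ϖ ∉ 𝔮` and every `n`, then
`∃ k, ∀ G ∈ I, C (ϖ ^ k) * G ∈ (L)`. [cite: Washington1997, §13.2] -/
theorem PowerSeries.exists_C_pow_mul_mem_span_of_forall_heightOne {ϖ : 𝒪} (hϖ : Prime ϖ)
    (L : 𝒪⟦X⟧) (I : Ideal 𝒪⟦X⟧)
    (h : ∀ 𝔮 : PrimeSpectrum 𝒪⟦X⟧, 𝔮.asIdeal.height = 1 → C ϖ ∉ 𝔮.asIdeal →
      ∀ n : ℕ, Ideal.span {L} ≤ 𝔮.asIdeal ^ n → I ≤ 𝔮.asIdeal ^ n) :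
    ∃ k : ℕ, ∀ G ∈ I, C (ϖ ^ k) * G ∈ Ideal.span {L} := by
  have hprime : Prime (C ϖ : 𝒪⟦X⟧) := prime_C_of_prime hϖ
  have h0 : constantCoeff (C ϖ : 𝒪⟦X⟧) ≠ 0 := by
    rw [constantCoeff_C]; exact hϖ.ne_zero
  obtain ⟨k, hk⟩ := PowerSeries.exists_pow_mul_mem_span_of_forall_heightOne hprime h0 L I h
  exact ⟨k, fun G hG => by rw [map_pow]; exact hk G hG⟩

end PowerSeries

/-! ### The Eisenstein-direction bridge: `length_𝔮 R/(L) ≤ length_𝔮 X` at `𝔮 ∌ π₀` ⟹ `π₀ᵏ · char(X) ⊆ (L)` -/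

section EisensteinBridge

variable {R : Type*} [CommRing R] [IsDomain R] [IsNoetherianRing R] [UniqueFactorizationMonoid R]
  {X : Type*} [AddCommGroup X] [_root_.Module R X]

/-- **From the printed output of an Eisenstein-congruence argument to a divisibility.** `R` a
Noetherian UFD, `X` a finitely generated torsion `R`-module, `π₀` prime, `L ≠ 0`. If
`length_{R_𝔮} (R/(L))_𝔮 ≤ length_{R_𝔮} X_𝔮` (i.e. `ord_𝔮(L) ≤ length_𝔮(X)`) for every height-one prime
`𝔮` with `π₀ ∉ 𝔮`, then `(π₀ ^ k) · char(X) ⊆ (L)` for some `k`. This is the shape in which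
Castella–Liu–Wan prove Thm. 8.2.1: "We reduce to show that given a height one prime ideal `P` … we have
the inequality `ord_P(𝓛) ≤ length_P(X_P)`" `[corpus: paper:arxiv-2109.08375 p0055 L48–L52]`; the
converse companion of `Module.exists_pow_mul_mem_charIdeal_of_lengthAt_le`. Proof: at `𝔮 = (π)`,
`(L) ⊆ 𝔮ⁿ` means `πⁿ ∣ L`, so `n ≤ length_𝔮 R/(L) ≤ length_𝔮 X` and `char(X) ⊆ (πⁿ)`
(`charIdeal_le_span_singleton_pow_of_le_lengthAt`); conclude by the height-one criterion.
[cite: Washington1997, §13.2] [cite: NeukirchSchmidtWingberg2008, Ch. V §3, (5.3.9)–(5.3.10)] -/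
theorem Module.exists_span_pow_mul_charIdeal_le_span_of_lengthAt_le [Module.Finite R X]
    (hX : Module.IsTorsion R X) {π₀ L : R} (hπ₀ : Prime π₀) (hL : L ≠ 0)
    (h : ∀ 𝔮 : PrimeSpectrum R, 𝔮.asIdeal.height = 1 → π₀ ∉ 𝔮.asIdeal →
      Module.lengthAt R (R ⧸ Ideal.span {L}) 𝔮 ≤ Module.lengthAt R X 𝔮) :
    ∃ k : ℕ, Ideal.span {π₀ ^ k} * Module.charIdeal R X ≤ Ideal.span {L} := by
  refine Ideal.exists_span_pow_mul_le_span_of_forall_heightOne hπ₀ hL fun 𝔮 h1 hπ₀𝔮 n hn => ?_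
  -- `𝔮 = (π)` for a prime element `π`
  have hne : 𝔮.asIdeal ≠ ⊥ := by
    intro hbot
    have := h1
    rw [hbot, Ideal.height_bot] at this
    exact zero_ne_one this
  obtain ⟨π, hπ𝔮, hπ⟩ := Ideal.IsPrime.exists_mem_prime_of_ne_bot 𝔮.isPrime hne
  have h𝔮 : 𝔮.asIdeal = Ideal.span {π} := Ideal.eq_span_singleton_of_height_eq_one h1 hπ𝔮 hπ
  -- `πⁿ ∣ L`, hence `n ≤ length_𝔮 R/(L) ≤ length_𝔮 X`
  have hdvd : π ^ n ∣ L := by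
    rw [h𝔮, Ideal.span_singleton_pow, Ideal.span_singleton_le_span_singleton] at hn
    exact hn
  have hnX : (n : ℕ∞) ≤ Module.lengthAt R X 𝔮 :=
    (Module.le_lengthAt_quotient_span_singleton_of_pow_dvd hπ hL 𝔮 h𝔮 hdvd).trans (h 𝔮 h1 hπ₀𝔮)
  rw [h𝔮, Ideal.span_singleton_pow]
  exact Module.charIdeal_le_span_singleton_pow_of_le_lengthAt hX hπ 𝔮 h𝔮 hnX

/-- Element form of the Eisenstein-direction bridge: `π₀ ^ k * G ∈ (L)` for every `G ∈ char(X)`.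
[cite: Washington1997, §13.2] -/
theorem Module.exists_pow_mul_mem_span_of_mem_charIdeal_of_lengthAt_le [Module.Finite R X]
    (hX : Module.IsTorsion R X) {π₀ L : R} (hπ₀ : Prime π₀) (hL : L ≠ 0)
    (h : ∀ 𝔮 : PrimeSpectrum R, 𝔮.asIdeal.height = 1 → π₀ ∉ 𝔮.asIdeal →
      Module.lengthAt R (R ⧸ Ideal.span {L}) 𝔮 ≤ Module.lengthAt R X 𝔮) :
    ∃ k : ℕ, ∀ G ∈ Module.charIdeal R X, π₀ ^ k * G ∈ Ideal.span {L} := by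
  obtain ⟨k, hk⟩ := Module.exists_span_pow_mul_charIdeal_le_span_of_lengthAt_le hX hπ₀ hL h
  exact ⟨k, fun G hG => hk (Ideal.mul_mem_mul (Ideal.mem_span_singleton_self _) hG)⟩

end EisensteinBridge

end Literature.NumberTheory.EllipticCurves

end
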